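import Literature.Probability.LatticeModels.GermRegionLattice
import HarnessLib

/-!
# Nested boundary arcs of the inner and outer germ regions

Sub-problem `CriticalPhenomena/SAWScalingLimit`, crux `AvoidanceLimit`
(`Summit.CriticalPhenomena.SAWScalingLimit.Theses.SAWLoopFugacityFlow.AvoidanceLimit`,
stmt-CriticalPhenomena-10649), line `symplectic-fermion-anchor`, stub W17.

Let `D` be a Jordan domain, `b` a centre, `0 < s < s'` two scales, `g ∈ D ∩ box b s` a base point
and `o ∈ D` a far point off the closed box of radius `s'`. The germ regions
`U = germRegion D b hs g o ⊆ U' = germRegion D b hs' g o` (`GermRegions.lean`, the regions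
`Ω_o(b,r)` of Chelkak–Wan 2021, §3.2, with boxes for discs; nesting `germRegion_mono`) are sides of
the germ gates, cross-cuts of `D` on the squares of radii `s`, `s'`; by Newman's cross-cut theorem
(`gateSide_gateFar_spec`) `frontier U = gateArc ∪ ∂D[σ₁, τ₁]` and `frontier U' = gateArc' ∪ ∂D[σ, τ]`
with `σ < τ < σ + 1`, `σ₁ < τ₁ < σ₁ + 1`. We prove (`exists_nested_germArcs`) that the inner
parameter pair can be re-normalised by an integer shift so that it nests strictly inside the outer
one: `σ < θ₁ < θ₂ < τ`, `∂D[θ₁, θ₂] = ∂D[σ₁, τ₁]`, with the same end-points. Geometric input: the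
outer gate arc misses the closure of the inner region (`not_mem_closure_germRegion_of_mem_gateArc`:
the outer gate lies in the inner far side, and the closures of the two inner sides meet only along
the inner gate arc, which lies on the other square), whence the inner boundary arc lies inside the
outer one (`image_boundary_Icc_subset_of_nested`) and avoids the outer gate ends; the rest is
bookkeeping with the `1`-periodic boundary loop, injective on every period
(`exists_int_shift_nested`).

## References
* M. H. A. Newman, *Elements of the topology of plane sets of points*, Cambridge Univ. Press
  (1939), Ch. V §11, Thms. 11·7–11·8. [Newman1939]
* D. Chelkak, Y. Wan, *On the convergence of massive loop-erased random walks to massive SLE(2)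
  curves*, Electron. J. Probab. 26 (2021), §3.2. [ChelkakWan2021]
-/

noncomputable section

open scoped BigOperators Classical
open Set Metric Filter Topology
open Literature.Topology.PlaneTopology
open Literature.Probability.LatticeModels
open Literature.Probability.RandomPlanarGeometry (JordanDomain)

namespace Summit.CriticalPhenomena.SAWScalingLimit.Theorems.AvoidanceLimit.Anchor

/-! ### Parameter bookkeeping on the boundary loop -/

/-- Boundary arcs are invariant under an integer shift of the parameter interval (the boundary
loop is `1`-periodic). [folklore] -/
theorem image_boundary_Icc_add_int (D : JordanDomain) (a c : ℝ) (k : ℤ) :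
    D.boundary '' Set.Icc (a + k) (c + k) = D.boundary '' Set.Icc a c := by
  rw [← image_add_const_Icc, ← image_comp]
  refine image_congr fun θ _ => ?_
  show D.boundary (θ + k) = D.boundary θ
  simpa using D.periodic_boundary.int_mul k θ

/-- **Re-normalising a sub-arc.** If the boundary arc `∂D[σ₁, τ₁]` (`σ₁ < τ₁ < σ₁ + 1`) lies in the
arc `∂D[σ, τ]` (`σ < τ < σ + 1`) and contains neither of its ends `D.boundary σ`, `D.boundary τ`,
then after an integer shift `k` of the parameters `σ < σ₁ + k` and `τ₁ + k < τ` (reduce `σ₁` into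
the period `[σ, σ + 1)`, where the loop is injective; the shifted interval cannot run past `τ`,
else `D.boundary τ` would lie on the sub-arc). [folklore] -/
theorem exists_int_shift_nested (D : JordanDomain) {σ τ σ₁ τ₁ : ℝ} (hτσ : τ < σ + 1)
    (hστ₁ : σ₁ < τ₁)
    (harc : D.boundary '' Set.Icc σ₁ τ₁ ⊆ D.boundary '' Set.Icc σ τ)
    (hσ : D.boundary σ ∉ D.boundary '' Set.Icc σ₁ τ₁)
    (hτ : D.boundary τ ∉ D.boundary '' Set.Icc σ₁ τ₁) :
    ∃ k : ℤ, σ < σ₁ + k ∧ τ₁ + k < τ := by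
  set k : ℤ := -⌊σ₁ - σ⌋ with hk
  have h1 := Int.floor_le (σ₁ - σ)
  have h2 := Int.lt_floor_add_one (σ₁ - σ)
  have hk1 : σ ≤ σ₁ + k := by rw [hk]; push_cast; linarith
  have hk2 : σ₁ + k < σ + 1 := by rw [hk]; push_cast; linarith
  -- the shifted lower end has the same image, which lies on the big arc
  have hθ₁eq : D.boundary (σ₁ + k) = D.boundary σ₁ := by
    simpa using D.periodic_boundary.int_mul k σ₁
  have hmem₁ : D.boundary σ₁ ∈ D.boundary '' Set.Icc σ₁ τ₁ := ⟨σ₁, left_mem_Icc.2 hστ₁.le, rfl⟩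
  obtain ⟨φ, hφ, hφeq⟩ := harc hmem₁
  have hφθ : φ = σ₁ + k :=
    D.injOn_boundary_Ico σ ⟨hφ.1, lt_of_le_of_lt hφ.2 hτσ⟩ ⟨hk1, hk2⟩ (by rw [hφeq, hθ₁eq])
  have hθ₁le : σ₁ + k ≤ τ := hφθ ▸ hφ.2
  have hσlt : σ < σ₁ + k := by
    refine lt_of_le_of_ne hk1 fun h => hσ ?_
    rw [h, hθ₁eq]; exact hmem₁
  refine ⟨k, hσlt, ?_⟩
  by_contra hge
  apply hτ
  rw [← image_boundary_Icc_add_int D σ₁ τ₁ k]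
  exact ⟨τ, ⟨hθ₁le, not_lt.1 hge⟩, rfl⟩

/-! ### The outer gate arc misses the closure of the inner germ region -/

/-- **The outer gate arc misses the closure of the inner germ region.** For scales `s < s'` (base
point `g` in the small box, far point `o` off the large closed box) no point of the gate arc of the
outer germ region lies in the closure of the inner germ region `U(s)`: the outer gate is a
connected subset of `D` off the inner gate (the two squares are disjoint) and off `U(s) ⊆ U(s')`,
hence inside the inner far region; its closure contains the outer gate arc, and the closures of
the two sides of the inner gate meet only along the inner gate arc (Newman), which lies on the
inner square. [cite: Newman1939, Ch. V §11, Thms. 11·7–11·8] -/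
theorem not_mem_closure_germRegion_of_mem_gateArc {D : JordanDomain} {b : ℂ} {s s' : ℝ}
    (hs : 0 < s) (hs' : 0 < s') (hss' : s < s')
    (h2 : TwoOff D (boxJD b hs)) (h2' : TwoOff D (boxJD b hs')) {g o : ℂ}
    (hg : g ∈ D.carrier ∩ Literature.Topology.PlaneTopology.box b s) (ho : o ∈ D.carrier)
    (hoc : o ∉ closedBox b s') {z : ℂ}
    (hz : z ∈ gateArc D (boxJD b hs') (germGateParam D b hs' g o)) :
    z ∉ closure (germRegion D b hs g o) := by
  intro hzU
  have hg' : g ∈ D.carrier ∩ Literature.Topology.PlaneTopology.box b s' :=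
    ⟨hg.1, Literature.Topology.PlaneTopology.box_mono hss'.le hg.2⟩
  have hocs : o ∉ closedBox b s := fun h => hoc (closedBox_mono hss'.le h)
  obtain ⟨ht, -, -⟩ := germGateParam_spec h2 hg ho hocs
  obtain ⟨ht', -, -⟩ := germGateParam_spec h2' hg' ho hoc
  have hgq := base_not_mem_gate hs hg (germGateParam D b hs g o)
  have hUU' : germRegion D b hs g o ⊆ germRegion D b hs' g o :=
    germRegion_mono hs hss' h2 h2' hg ho hoc
  -- the two squares are disjoint
  have hsq : ∀ w, w ∈ closedBox b s \ Literature.Topology.PlaneTopology.box b s →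
      w ∈ closedBox b s' \ Literature.Topology.PlaneTopology.box b s' → False :=
    fun w h1 h1' => h1'.2 (closedBox_subset_box hss' h1.1)
  -- the outer gate lies in the inner far region
  have hS'far : germGate D b hs' g o ⊆ germFar D b hs g o := by
    have hcov : germGate D b hs' g o ⊆ germRegion D b hs g o ∪ germFar D b hs g o := by
      rw [germRegion_union_germFar]
      intro w hw
      exact ⟨gate_subset_carrier _ hw, fun hw' => hsq w
        (germGate_subset_square (hs := hs) (g := g) (o := o) hw')
        (germGate_subset_square (hs := hs') (g := g) (o := o) hw)⟩
    rcases (isPreconnected_gate _).subset_or_subset (isOpen_germRegion h2 hg ho hocs)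
      (isOpen_germFar h2 hg ho hocs) disjoint_germRegion_germFar hcov with h | h
    · exfalso
      obtain ⟨q, hq⟩ := germGate_nonempty h2' hg' ho hoc
      have hqU' : q ∈ gateSide D (boxJD b hs') g (germGateParam D b hs' g o) := hUU' (h hq)
      exact (gateSide_subset g _ hqU').2 hq
    · exact h
  -- the outer gate arc lies in the closure of the outer gate
  have hlt : gateLo D (boxJD b hs') (germGateParam D b hs' g o) <
      gateHi D (boxJD b hs') (germGateParam D b hs' g o) :=
    (gateLo_lt h2' ht').trans (lt_gateHi h2' ht')
  have hzS' : z ∈ closure (germGate D b hs' g o) := by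
    have hz' : z ∈ (boxJD b hs').boundary '' closure (Ioo (gateLo D (boxJD b hs') (germGateParam D b hs' g o))
        (gateHi D (boxJD b hs') (germGateParam D b hs' g o))) := by
      rw [closure_Ioo hlt.ne]; exact hz
    exact image_closure_subset_closure_image (boxJD b hs').continuous_boundary hz'
  -- so `z` is on the inner gate arc, on the inner square: impossible
  have hzA : z ∈ gateArc D (boxJD b hs) (germGateParam D b hs g o) :=
    closure_gateSide_inter_closure_gateFar h2 ht hgq ⟨hzU, closure_mono hS'far hzS'⟩
  have h1 : z ∈ closedBox b s \ Literature.Topology.PlaneTopology.box b s := by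
    rw [← range_boxJD_boundary b hs]; exact gateArc_subset_range _ hzA
  have h1' : z ∈ closedBox b s' \ Literature.Topology.PlaneTopology.box b s' := by
    rw [← range_boxJD_boundary b hs']; exact gateArc_subset_range _ hz
  exact hsq z h1 h1'

/-- **The inner boundary arc lies inside the outer one.** With the frontier identities
`frontier U(s) = gateArc(s) ∪ ∂D[σ₁, τ₁]` and `frontier U(s') = gateArc(s') ∪ ∂D[σ, τ]` of the
nested germ regions `U(s) ⊆ U(s')`, the arc `∂D[σ₁, τ₁]` is contained in `∂D[σ, τ]`: its points
are in `closure U(s) ⊆ closure U(s')` and off the open `U(s') ⊆ D`, hence on `frontier U(s')`,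
and not on the outer gate arc (`not_mem_closure_germRegion_of_mem_gateArc`).
[cite: Newman1939, Ch. V §11, Thms. 11·7–11·8] -/
theorem image_boundary_Icc_subset_of_nested {D : JordanDomain} {b : ℂ} {s s' : ℝ}
    (hs : 0 < s) (hs' : 0 < s') (hss' : s < s')
    (h2 : TwoOff D (boxJD b hs)) (h2' : TwoOff D (boxJD b hs')) {g o : ℂ}
    (hg : g ∈ D.carrier ∩ Literature.Topology.PlaneTopology.box b s) (ho : o ∈ D.carrier)
    (hoc : o ∉ closedBox b s') {σ₁ τ₁ σ τ : ℝ}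
    (hfU : frontier (germRegion D b hs g o) =
      gateArc D (boxJD b hs) (germGateParam D b hs g o) ∪ D.boundary '' Set.Icc σ₁ τ₁)
    (hfU' : frontier (germRegion D b hs' g o) =
      gateArc D (boxJD b hs') (germGateParam D b hs' g o) ∪ D.boundary '' Set.Icc σ τ) :
    D.boundary '' Set.Icc σ₁ τ₁ ⊆ D.boundary '' Set.Icc σ τ := by
  rintro _ ⟨θ, hθ, rfl⟩
  have hg' : g ∈ D.carrier ∩ Literature.Topology.PlaneTopology.box b s' :=
    ⟨hg.1, Literature.Topology.PlaneTopology.box_mono hss'.le hg.2⟩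
  have hUU' : germRegion D b hs g o ⊆ germRegion D b hs' g o :=
    germRegion_mono hs hss' h2 h2' hg ho hoc
  have hzfr : D.boundary θ ∈ frontier (germRegion D b hs g o) := by
    rw [hfU]; exact Or.inr ⟨θ, hθ, rfl⟩
  have hzcl : D.boundary θ ∈ closure (germRegion D b hs g o) := frontier_subset_closure hzfr
  have hznot : D.boundary θ ∉ germRegion D b hs' g o := fun h =>
    Set.disjoint_left.1 D.disjoint_carrier_frontier (germRegion_subset_carrier h)
      (D.boundary_mem_frontier θ)
  have hzfr' : D.boundary θ ∈ frontier (germRegion D b hs' g o) :=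
    ⟨closure_mono hUU' hzcl, by rw [(isOpen_germRegion h2' hg' ho hoc).interior_eq]; exact hznot⟩
  rw [hfU'] at hzfr'
  rcases hzfr' with h | h
  · exact absurd hzcl (not_mem_closure_germRegion_of_mem_gateArc hs hs' hss' h2 h2' hg ho hoc h)
  · exact h

/-! ### The nested arcs -/

/-- **Nested boundary arcs of the inner and outer germ regions** (stub W17 of the line
`symplectic-fermion-anchor`). For a Jordan domain `D`, scales `0 < s < s'` whose boundary squares
about `b` each have two points off `D`, a base point `g ∈ D ∩ box b s` and a far point `o ∈ D`
off the closed box of radius `s'`, there are parameters `σ' < θ₁ < θ₂ < τ' < σ' + 1` such that the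
frontier of the outer germ region is its gate arc together with `∂D[σ', τ']`, the frontier of the
inner germ region is its gate arc together with `∂D[θ₁, θ₂]`, and `D.boundary θ₁, D.boundary θ₂`
(resp. `D.boundary σ', D.boundary τ'`) are the two ends of the inner (resp. outer) gate. Newman's
cross-cut theorem gives both frontier identities (`gateSide_gateFar_spec`); the inner arc lies in
the outer one and avoids the outer gate ends (`image_boundary_Icc_subset_of_nested`,
`not_mem_closure_germRegion_of_mem_gateArc`), and the inner parameter pair is re-normalised by an
integer shift (`exists_int_shift_nested`). [cite: Newman1939, Ch. V §11, Thms. 11·7–11·8] -/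
theorem exists_nested_germArcs :
    ∀ (D : JordanDomain) (b : ℂ) (s s' : ℝ) (hs : 0 < s) (hs' : 0 < s'), s < s' → ∀ (g o : ℂ),
      TwoOff D (boxJD b hs) → TwoOff D (boxJD b hs') →
      g ∈ D.carrier ∩ Literature.Topology.PlaneTopology.box b s → o ∈ D.carrier → o ∉ closedBox b s' →
      ∃ σ' θ₁ θ₂ τ' : ℝ, σ' < θ₁ ∧ θ₁ < θ₂ ∧ θ₂ < τ' ∧ τ' < σ' + 1 ∧
        frontier (germRegion D b hs' g o) =
          gateArc D (boxJD b hs') (germGateParam D b hs' g o) ∪ D.boundary '' Set.Icc σ' τ' ∧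
        frontier (germRegion D b hs g o) =
          gateArc D (boxJD b hs) (germGateParam D b hs g o) ∪ D.boundary '' Set.Icc θ₁ θ₂ ∧
        ({D.boundary θ₁, D.boundary θ₂} : Set ℂ) =
          {(boxJD b hs).boundary (gateLo D (boxJD b hs) (germGateParam D b hs g o)),
           (boxJD b hs).boundary (gateHi D (boxJD b hs) (germGateParam D b hs g o))} ∧
        ({D.boundary σ', D.boundary τ'} : Set ℂ) =
          {(boxJD b hs').boundary (gateLo D (boxJD b hs') (germGateParam D b hs' g o)),
           (boxJD b hs').boundary (gateHi D (boxJD b hs') (germGateParam D b hs' g o))} := by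
  intro D b s s' hs hs' hss' g o h2 h2' hg ho hoc
  have hg' : g ∈ D.carrier ∩ Literature.Topology.PlaneTopology.box b s' :=
    ⟨hg.1, Literature.Topology.PlaneTopology.box_mono hss'.le hg.2⟩
  have hocs : o ∉ closedBox b s := fun h => hoc (closedBox_mono hss'.le h)
  obtain ⟨ht, -, -⟩ := germGateParam_spec h2 hg ho hocs
  obtain ⟨ht', -, -⟩ := germGateParam_spec h2' hg' ho hoc
  have hgq := base_not_mem_gate hs hg (germGateParam D b hs g o)
  have hgq' := base_not_mem_gate hs' hg' (germGateParam D b hs' g o)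
  obtain ⟨-, -, -, -, σ₁, τ₁, hστ₁, -, hends, hfU, -⟩ := gateSide_gateFar_spec h2 ht hgq
  obtain ⟨-, -, -, -, σ, τ, hστ, hτσ, hends', hfU', -⟩ := gateSide_gateFar_spec h2' ht' hgq'
  -- the frontier identities, for the germ regions
  have hfU : frontier (germRegion D b hs g o) =
      gateArc D (boxJD b hs) (germGateParam D b hs g o) ∪ D.boundary '' Set.Icc σ₁ τ₁ := hfU
  have hfU' : frontier (germRegion D b hs' g o) =
      gateArc D (boxJD b hs') (germGateParam D b hs' g o) ∪ D.boundary '' Set.Icc σ τ := hfU'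
  -- (1) the inner arc lies in the outer arc
  have harc := image_boundary_Icc_subset_of_nested hs hs' hss' h2 h2' hg ho hoc hfU hfU'
  -- (2) the outer gate ends are off the inner arc
  have hAcl : D.boundary '' Set.Icc σ₁ τ₁ ⊆ closure (germRegion D b hs g o) := fun z hz =>
    frontier_subset_closure (by rw [hfU]; exact Or.inr hz)
  have hendsA : ({D.boundary σ, D.boundary τ} : Set ℂ) ⊆
      gateArc D (boxJD b hs') (germGateParam D b hs' g o) := by
    rw [hends']
    have hA := isSimpleArc_gateArc h2' ht'
    rintro z (rfl | rfl)
    · exact hA.left_mem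
    · exact hA.right_mem
  have hσ : D.boundary σ ∉ D.boundary '' Set.Icc σ₁ τ₁ := fun h =>
    not_mem_closure_germRegion_of_mem_gateArc hs hs' hss' h2 h2' hg ho hoc
      (hendsA (mem_insert _ _)) (hAcl h)
  have hτ : D.boundary τ ∉ D.boundary '' Set.Icc σ₁ τ₁ := fun h =>
    not_mem_closure_germRegion_of_mem_gateArc hs hs' hss' h2 h2' hg ho hoc
      (hendsA (mem_insert_of_mem _ (mem_singleton _))) (hAcl h)
  -- (3) re-normalise the inner parameter pair
  obtain ⟨k, hk1, hk2⟩ := exists_int_shift_nested D hτσ hστ₁ harc hσ hτ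
  have hper : ∀ θ : ℝ, D.boundary (θ + k) = D.boundary θ := fun θ => by
    simpa using D.periodic_boundary.int_mul k θ
  refine ⟨σ, σ₁ + k, τ₁ + k, τ, hk1, by linarith, hk2, hτσ, hfU', ?_, ?_, hends'⟩
  · rw [image_boundary_Icc_add_int]; exact hfU
  · rw [hper, hper]; exact hends

end Summit.CriticalPhenomena.SAWScalingLimit.Theorems.AvoidanceLimit.Anchor

end
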